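import Summits.AtomisticToContinuum.HydrodynamicLimit.Theses.RelayRaceLocality
import Summits.AtomisticToContinuum.HydrodynamicLimit.Theorems.RelayRaceLocalityNearConstantShortTimeHLEntropyToLLN
import Summits.AtomisticToContinuum.HydrodynamicLimit.Theorems.RelayRaceLocalityNearConstantShortTimeHLMeansPinDefs
import Summits.AtomisticToContinuum.HydrodynamicLimit.Theorems.RelayRaceLocalityNearConstantShortTimeHLTiltDomination
import Summits.AtomisticToContinuum.HydrodynamicLimit.Theorems.RelayRaceLocalityNearConstantShortTimeHLMeansPin
import Summits.AtomisticToContinuum.HydrodynamicLimit.Theorems.RelayRaceLocalityNearConstantShortTimeHLGeneralFamilyLDA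
import Summits.AtomisticToContinuum.HydrodynamicLimit.Theorems.RelayRaceLocalityNearConstantShortTimeHLMeansNecessary
import Summits.AtomisticToContinuum.HydrodynamicLimit.Theorems.NearConstantShortTimeHL.Negative.LoadBearing
import Summits.AtomisticToContinuum.HydrodynamicLimit.Theorems.NearConstantShortTimeHL.Negative.LawDichotomy
import HarnessLib

/-!
# Line `means-pin-entropy` for crux `NearConstantShortTimeHL` (stmt-AtomisticToContinuum-12502) — skeleton v4 (lead a1)

Lead prover-line-stmt-AtomisticToContinuum-12502-a1-0 (2026-08-16), continuing the planner's skeleton v1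
(`Cruxes/NearConstantShortTimeHL/Lines/means_pin_entropy.lean`, planner-cruxplan-…-means-pin-entropy-0). v4 changes
NOTHING in the registered stub names/signatures; it IMPORTS the typed statements and every stub landed so far from the
tree (so that `NearConstantShortTimeHL_of` uses the landed theorems and the sorries are exactly the open stubs):

* `Theorems/RelayRaceLocalityNearConstantShortTimeHLMeansPin.lean` (p113155, ACCEPTED; helpers …MeansPinStatics p110971,
  …MeansPinEntropy p111046): **S4 `stub_meansPin` PROVED** (the pin: Yau's bookkeeping at the Euler-matched reference);
* `Theorems/RelayRaceLocalityNearConstantShortTimeHLGeneralFamilyLDA.lean` (p115176, ACCEPTED; helpers …GeneralFamilyFreeEnergy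
  p110923, …GeneralFamilyFreeEnergyThermo p113205, …GeneralFamilyMeanDensity p111931, …GeneralGibbs p112317): **S1
  `stub_ldaGeneralFamilies` PROVED** (general-family LDA from the conjunct-family free energy — 13459's
  `HardSphereLDA.tendsto_freeEnergy_continuous`, landed meanwhile — by the diameter-monotonicity sandwich + convexity);
* `Theorems/RelayRaceLocalityNearConstantShortTimeHLMeansNecessary.lean` (p112208, ACCEPTED; helpers …Static/Tools/Fields/
  Kinetic): the CONVERSE `meansConverge_of_nearConstantShortTimeHL : NearConstantShortTimeHL → MeansConverge` (lead);
* `Theorems/RelayRaceLocalityNearConstantShortTimeHLMeansPinDockNC.lean` (p113063, ACCEPTED): the second engine's currency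
  `MeansConvergeNC ↔ MeansConverge` (lead; `eulerVal` of the tilt-radius skeleton repaired);

* `Theorems/RelayRaceLocalityNearConstantShortTimeHLMeansPinDefs.lean` (p110264, ACCEPTED): `GeneralFamilyLDA`,
  `GeneralFamilyConcentration`, `OneMeanLowerBound`, `MeansConverge` (verbatim v1 texts) and the PROVED engine bridge
  `oneMeanLowerBound_of_meansConverge : MeansConverge → OneMeanLowerBound` (registered sub-goal);
* `Theorems/RelayRaceLocalityNearConstantShortTimeHLTiltDomination.lean` (p110739, ACCEPTED): `TiltDomination` and the
  PROVED `stub_smallTiltDomination : TiltDomination` (small-tilt-domination S1, the first engine piece behind the bridge).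

Open stubs (registered, unchanged): `stub_concentrationGeneralFamilies` (statics, L; wave 1: proof complete, landing waits
for the hub build of its helper modules), `stub_oneMeanLowerBound` (ENGINE SLOT, open-problem — lead; by the landed bridge + converse it is
EXACTLY crux-strength modulo S1/S2: `NearConstantShortTimeHL → MeansConverge → OneMeanLowerBound → (S1 → S2 →) NearConstantShortTimeHL`;
fed by an engine producing `MeansConverge` — small-tilt-domination S2–S5 behind the landed `TiltDomination`, or tilt-radius via
`MeansConvergeNC`). Composition `NearConstantShortTimeHL_of` is sorry-free and concludes the crux BY NAME; sorries = S2, S3.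

Disproof honoured (`Cruxes/NearConstantShortTimeHL/Disproof.lean` cycle 1; landed `Negative/LoadBearing`,
`Negative/LawDichotomy`, imported): the tie is used in `stub_meansPin` (identification of the Euler data at `t = 0`)
and kept verbatim in `stub_oneMeanLowerBound` (`nearConstantShortTimeHLUntied_false`); the balance laws are used in
`stub_meansPin` through mass conservation and isentropy (`nearConstantShortTimeHLNoPDE_false`);
`isProbabilityMeasure_particleLaw_iff_ne_zero` is the normalisation dichotomy the pin uses. No `-- Targets` section and no
`stub_*_false` in the disproof file at 16:40Z.
-/

noncomputable section

namespace Summit.AtomisticToContinuum.HydrodynamicLimit.Cruxes.NearConstantShortTimeHL.MeansPinEntropy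

open MeasureTheory Filter Set Topology
open scoped ENNReal
open Literature.MathematicalPhysics.KineticTheory Literature.Analysis.FluidPDE Literature.Analysis.FunctionSpaces
open Summit.AtomisticToContinuum.HydrodynamicLimit.Theses.RelayRaceLocality (NearConstantShortTimeHL)
open Summit.AtomisticToContinuum.HydrodynamicLimit.Theorems.NearConstantShortTimeHL
  (NearConstantRelEntropy stub_entropyToLLN GeneralFamilyLDA GeneralFamilyConcentration OneMeanLowerBound
   MeansConverge TiltDomination oneMeanLowerBound_of_meansConverge stub_smallTiltDomination stub_meansPin
   stub_ldaGeneralFamilies meansConverge_of_nearConstantShortTimeHL)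
open Summit.AtomisticToContinuum.HydrodynamicLimit.Theorems.NearConstantShortTimeHLNegative
  (NearConstantShortTimeHLUntied nearConstantShortTimeHLUntied_false
   NearConstantShortTimeHLNoPDE nearConstantShortTimeHLNoPDE_false)

/-! ## Scratch check against the landed negatives and the landed engine pieces -/

/-- The `t = 0` tie is load-bearing (landed): consumed in `stub_meansPin`, kept in `stub_oneMeanLowerBound`. -/
example : ¬ NearConstantShortTimeHLUntied := nearConstantShortTimeHLUntied_false

/-- The Euler balance laws are load-bearing (landed): consumed in `stub_meansPin` (mass conservation, isentropy). -/
example : ¬ NearConstantShortTimeHLNoPDE := nearConstantShortTimeHLNoPDE_false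

/-- ENGINE BRIDGE (landed p110264): any engine producing `MeansConverge` closes the engine slot. -/
example : MeansConverge → OneMeanLowerBound := oneMeanLowerBound_of_meansConverge

/-- FIRST ENGINE PIECE (landed p110739): small-tilt domination (small-tilt-domination S1). -/
example : TiltDomination := stub_smallTiltDomination

/-- CONVERSE (landed p112208): the engine target is NECESSARY — the crux implies convergence of the means. -/
example : NearConstantShortTimeHL → MeansConverge := meansConverge_of_nearConstantShortTimeHL

-- SECOND ENGINE'S CURRENCY (landed p113063, `…MeansPinDockNC.lean`, not imported here to keep the header light):
-- `meansConverge_of_meansConvergeNC : MeansConvergeNC → MeansConverge`, so tilt-radius docks on the slot too.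

/-- THE PIN (landed p113155): S4 `stub_meansPin`, a tree theorem. -/
example : GeneralFamilyLDA → GeneralFamilyConcentration → OneMeanLowerBound → NearConstantRelEntropy := stub_meansPin

/-- S1 (landed p115176): general-family local density approximation, a tree theorem. -/
example : GeneralFamilyLDA := stub_ldaGeneralFamilies

/-! ## Registered stubs (names and signatures as registered on the crux item) -/

/-- **S2 (statics, L)** — general-family exponential concentration of the matched local Gibbs laws
(`GeneralFamilyConcentration`, tree def). Wave 1. -/
theorem stub_concentrationGeneralFamilies : GeneralFamilyConcentration := by
  sorry

/-- **S3 (ENGINE SLOT, open-problem; lead)** — the one-sided one-mean lower bound at time `t` (`OneMeanLowerBound`, tree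
def). Reached from `MeansConverge` by the landed bridge; `MeansConverge` is the output of the engine lines. -/
theorem stub_oneMeanLowerBound : OneMeanLowerBound := by
  sorry

/-! ## Composition -/

/-- **The line closes the crux modulo its stubs**: `stub_entropyToLLN (stub_meansPin S1 S2 S3)` concludes
`RelayRaceLocality.NearConstantShortTimeHL` BY NAME (`stub_entropyToLLN` p100911, `stub_meansPin` p113155, `stub_ldaGeneralFamilies` p115176 landed). -/
theorem NearConstantShortTimeHL_of : NearConstantShortTimeHL :=
  stub_entropyToLLN (stub_meansPin stub_ldaGeneralFamilies stub_concentrationGeneralFamilies stub_oneMeanLowerBound)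

end Summit.AtomisticToContinuum.HydrodynamicLimit.Cruxes.NearConstantShortTimeHL.MeansPinEntropy

end
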